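import Summits.HubbardSuperconductivity.HubbardSuperconductivity.Theorems.AposterioriCapRgSsbToEvenTorusLroLadderInduction
import Summits.HubbardSuperconductivity.HubbardSuperconductivity.Theorems.AposterioriCapRgSsbToEvenTorusLroLadderWeakRigidity
import Summits.HubbardSuperconductivity.HubbardSuperconductivity.Theorems.AposterioriCapRgSsbToEvenTorusLroPairTransferRung
import Summits.HubbardSuperconductivity.HubbardSuperconductivity.Theorems.AposterioriCapRgSsbToEvenTorusLroSeedOfCrux
import Summits.HubbardSuperconductivity.HubbardSuperconductivity.Theorems.AposterioriCapRgSsbToEvenTorusLroSummitSectorSeed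
import Summits.HubbardSuperconductivity.HubbardSuperconductivity.Theorems.AposterioriCapRgSsbToEvenTorusLroFacePurityOfGcRepelledChord
import Summits.HubbardSuperconductivity.HubbardSuperconductivity.Theorems.AposterioriCapRgSsbToEvenTorusLroFacePurityOfRepelledOrder
import HarnessLib

/-!
# Crux `SsbToEvenTorusLro` (stmt-HubbardSuperconductivity-1315) — SKELETON v7 (final): line `floating-mu-two-sided-pair-transfer`
# (text of lead c3, prover-line-stmt-HubbardSuperconductivity-1315-c3-0; published and registered by lead c4, …-c4-0, once the oleans of
# `…LadderInduction` / `…LadderWeakRigidity` / `…SeedOfCrux` / `…SummitSectorSeed` were built; published as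
# `Cruxes/SsbToEvenTorusLro/Lines/floating_mu_two_sided_pair_transfer.lean`; supersedes v6 / v7-interim)
#
# LEAD c4 VERDICT (2026-08-16): this line — and the two other lines of the crux — are DEAD as prover lines under L5 clause 3
# (`Lines/floating-mu-two-sided-pair-transfer-dead.md`, `Lines/number-projected-canonical-slope-dead.md`, `Lines/pair-yrast-landau-floor-dead.md`;
# three waves, eleven stub-workers, all `stub-blocked` with named missing theorems). Every finite-dimensional stub is a tree theorem imported
# below; the six `sorry`s are the open problem the crux names (Koma–Tasaki: SSB ⇒ every finite-volume sector ground state ordered, for the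
# doped repulsive 2D Hubbard model), not suppliable by any `Leans on:`. This file is the SKELETON OF RECORD for the crux census.

Route `AposterioriCapRg`, crux rank 5: Koma–Tasaki `d`-wave order + grand-canonical density matching ⇒ `d`-wave
pair-field LRO of EVERY normalised `(N_L, S^z = 0)`-sector ground state on even tori (`HasDWavePairFieldLROAt U δ`,
definitionally the crux body).

THE LINE: the finite-`L` SECTOR-HOPPING ENGINE (tower of states) of idea card `Ideas/floating-mu-two-sided-pair-transfer.md`.
STATE AFTER LEAD c3: the engine is CLOSED — every finite-dimensional piece is a tree theorem and is imported here; the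
only `sorry`s left are the three physics residues of the line (SEED — crux-NECESSARY —, RIGIDITY, CONVEXITY) and the two
sibling residues carried for the census (FP — crux-NECESSARY —, leak).

* `stub_pairTransferRung` (RUNG) — LANDED p97885 (`Theorems.stub_pairTransferRung`, lead …-1315-1).
* `stub_lowManifoldTransfer` (TRANSFER) — LANDED p100011 (`Theorems.stub_lowManifoldTransfer`, lead …-1315-1).
* one-rung steps `stub_ladderInductionRungDown/Up` — LANDED p102355 (lead …-1315-1).
* `stub_ladderInductionChains` (CHAINS) — LANDED p112352 (lead c3's worker).
* `stub_ladderSeedStep`, `lil_ladder_fixedL` (seed step, fixed-`L` ladder) — LANDED p114203 (lead c3).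
* `stub_ladderInductionOfChains`, `stub_ladderInduction` (INDUCTION), `stub_ladderPropagation` (the planner's LADDER) —
  LANDED p115281 (lead c3): constants `a = (1−δ)/4`, `E₁' = max E₁ 1`, `A = 8KE₁'/b + 2E₁'`, `ρ = |C_rig|/L`,
  `s = C_conv⁺/L²`, `θ = s + 8C_r/(bL²)`, `F_min = bL⁴/2`; thresholds incl. `L^{−ε} ≤ b/(4(D+1))` (`tendsto_rpow_neg_atTop`).
* `sourcedBrightSeed_of_crux` — LANDED p114473: SEED is crux-NECESSARY (seed = a ground state of the sector `N_L`).
* `SsbToEvenTorusLro_iff_summitSectorSeed` — LANDED p114795: under rigidity at the summit's OWN sector, the crux BY NAME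
  ⇔ ONE bright `O(1/L)`-excess unit vector in the sector `N_L` (no rung, no convexity) — the sharpest dissection.
* `stub_uniformFloorOfWeakRigidity` — LANDED p117927 (lead c3): the ladder under WEAK rigidity (tolerance `o(L^{3+ε})`).
* OPEN PHYSICS (registered signatures verbatim): `stub_sourcedBrightSeed` (SEED), `stub_lowManifoldRigidity` (RIGIDITY),
  `stub_lowManifoldRigidityWeak` (RIGIDITY, reshaped weak form), `stub_windowConvexity` (CONVEXITY); carried: `stub_facePurity` (FP),
  `stub_infraredLeak` (leak).

Composition: LADDER(RUNG, SEED, RIGIDITY, CONVEXITY) = the UNIFORM PAIR FLOOR at `(U, δ)` ⇒ the summit matrix by the LANDED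
kernel `WcbcsSsbToTorusLRO.Negative.hasDWavePairFieldLROAt_of_floor`; `SsbToEvenTorusLro_of` concludes the crux BY NAME;
door A′ `SsbToEvenTorusLro_of_weakRigidity` from SEED ∧ WEAK RIGIDITY ∧ CONVEXITY; `SsbToEvenTorusLro_iff_seed` : RIGIDITY → CONVEXITY → (crux ↔ SEED).
-/

noncomputable section

namespace Summit.HubbardSuperconductivity.HubbardSuperconductivity.Theorems.SsbToEvenTorusLro

-- summit = problem name (single-conjunct summit), D-0017
set_option linter.dupNamespace false

open Literature.MathematicalPhysics.QuantumLattice Literature.Probability.LatticeModels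
open Literature.Barriers.HubbardSuperconductivity (HasDWavePairFieldLROAt)
open Filter Set Matrix
open scoped ComplexOrder ComplexConjugate
open Summit.HubbardSuperconductivity.HubbardSuperconductivity.Theses.AposterioriCapRg (SsbToEvenTorusLro)
open Summit.HubbardSuperconductivity.WcbcsSsbToTorusLRO.Negative (hasDWavePairFieldLROAt_of_floor)

/-! ## Landed stubs of the line (no `sorry`) -/

/-- **(RUNG) stub_pairTransferRung** — LANDED p97885. Koma–Tasaki (1994) (2.9). [folklore] -/
theorem stub_pairTransferRung :
    ∀ (U a : ℝ), 0 < a → ∃ C : ℝ, ∀ (L : ℕ) [NeZero L] (m : ℕ) (ψ : Fock (Orb (FermionTorus 2 L))), a * (L : ℝ) ^ 2 ≤ (m : ℝ) → (m : ℝ) + 4 ≤ (2 - a) * (L : ℝ) ^ 2 → IsGroundStateInSector (hubbardTorus 2 L 1 U) (m + 2) 0 ψ → star ψ ⬝ᵥ ψ = 1 → pairField dWaveFormFactor L *ᵥ ψ ∈ szSector m 0 ∧ (pairField dWaveFormFactor L)ᴴ *ᵥ ψ ∈ szSector (m + 4) 0 ∧ (expect (hubbardTorus 2 L 1 U) (pairField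 dWaveFormFactor L *ᵥ ψ)).re - (hubbardTorus 2 L 1 U).minEnergyOn (szSector m 0) * (expect ((pairField dWaveFormFactor L)ᴴ * pairField dWaveFormFactor L) ψ).re + ((expect (hubbardTorus 2 L 1 U) ((pairField dWaveFormFactor L)ᴴ *ᵥ ψ)).re - (hubbardTorus 2 L 1 U).minEnergyOn (szSector (m + 4) 0) * (expect (pairField dWaveFormFactor L * (pairField dWaveFormFactor L)ᴴ) ψ).re) ≤ C * (L : ℝ) ^ 2 + max 0 (2 * (hubbardTorus 2 L 1 U).minEnergyOn (szSector (m + 2) 0) - (hubbardTorus 2 L 1 U).minEnergyOn (szSector m 0) - (hubbardTorus 2 L 1 U).minEnergyOn (szSector (m + 4) 0)) * (expect ((pairField dWaveFormFactor L)ᴴ * pairField dWaveFormFactor L) ψ).re ∧ (expect ((pairField dWaveFormFactor L)ᴴ * pairField dWaveFormFactor L) ψ).re ^ 2 - C * (L : ℝ) ^ 2 * (expect ((pairField dWaveFormFactor L)ᴴ * pairField dWaveFormFactor L) ψ).re ≤ (expect ((pairField dWaveFormFactor L)ᴴ * pairField dWaveFormFactor L) (pairField dWaveFormFactor L *ᵥ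 ψ)).re ∧ (expect (pairField dWaveFormFactor L * (pairField dWaveFormFactor L)ᴴ) ψ).re ^ 2 ≤ (expect ((pairField dWaveFormFactor L)ᴴ * pairField dWaveFormFactor L) ((pairField dWaveFormFactor L)ᴴ *ᵥ ψ)).re ∧ |(expect (pairField dWaveFormFactor L * (pairField dWaveFormFactor L)ᴴ) ψ).re - (expect ((pairField dWaveFormFactor L)ᴴ * pairField dWaveFormFactor L) ψ).re| ≤ C * (L : ℝ) ^ 2 :=
  Theorems.stub_pairTransferRung

/-- **(TRANSFER) stub_lowManifoldTransfer** — LANDED p100011. [folklore] -/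
theorem stub_lowManifoldTransfer :
    ∃ K : ℝ, 0 ≤ K ∧ ∀ (U : ℝ) (L : ℕ) [NeZero L] (n : ℕ) (τ ρ θ B lam : ℝ), 0 < τ → 0 ≤ ρ → 0 ≤ θ → 2 * θ ≤ τ → (∀ v ∈ Submodule.span ℂ {φ : Fock (Orb (FermionTorus 2 L)) | φ ∈ szSector n 0 ∧ ∃ E : ℝ, hubbardTorus 2 L 1 U *ᵥ φ = (E : ℂ) • φ ∧ E ≤ (hubbardTorus 2 L 1 U).minEnergyOn (szSector n 0) + τ}, (star (((pairField dWaveFormFactor L)ᴴ * pairField dWaveFormFactor L) *ᵥ v - ((lam * (L : ℝ) ^ 4 : ℝ) : ℂ) • v) ⬝ᵥ (((pairField dWaveFormFactor L)ᴴ * pairField dWaveFormFactor L) *ᵥ v - ((lam * (L : ℝ) ^ 4 : ℝ) : ℂ) • v)).re ≤ ρ ^ 2 * (L : ℝ) ^ 8 * (star v ⬝ᵥ v).re) → ∀ φ : Fock (Orb (FermionTorus 2 L)), φ ∈ szSector n 0 → star φ ⬝ᵥ φ = 1 → (expect (hubbardTorus 2 L 1 U) φ).re ≤ (hubbardTorus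 2 L 1 U).minEnergyOn (szSector n 0) + θ → B ≤ (expect ((pairField dWaveFormFactor L)ᴴ * pairField dWaveFormFactor L) φ).re → ∀ u ∈ Submodule.span ℂ {φ : Fock (Orb (FermionTorus 2 L)) | φ ∈ szSector n 0 ∧ ∃ E : ℝ, hubbardTorus 2 L 1 U *ᵥ φ = (E : ℂ) • φ ∧ E ≤ (hubbardTorus 2 L 1 U).minEnergyOn (szSector n 0) + τ}, star u ⬝ᵥ u = 1 → B - 4 * ρ * (L : ℝ) ^ 4 - K * (θ / τ) * (L : ℝ) ^ 4 ≤ (expect ((pairField dWaveFormFactor L)ᴴ * pairField dWaveFormFactor L) u).re :=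
  Theorems.stub_lowManifoldTransfer

/-- **(CHAINS) stub_ladderInductionChains** — LANDED p112352. [folklore] -/
theorem stub_ladderInductionChains :
    ∀ (G : ℕ → ℝ → Prop) (N m₀ : ℕ) (W F₀ ℓ Fmin : ℝ), Even N → Even m₀ → |(m₀ : ℝ) - (N : ℝ)| ≤ W → 2 ≤ m₀ → (∀ (m : ℕ) (F F' : ℝ), F' ≤ F → G m F → G m F') → G m₀ F₀ → (∀ (n : ℕ) (F : ℝ), Even n → N ≤ n → n + 2 ≤ m₀ → Fmin ≤ F → G (n + 2) F → G n (F - ℓ)) → (∀ (n : ℕ) (F : ℝ), Even n → m₀ ≤ n + 2 → n + 4 ≤ N → Fmin ≤ F → G (n + 2) F → G (n + 4) (F - ℓ)) → 0 ≤ ℓ → (∀ J' : ℝ, 0 ≤ J' → 2 * J' ≤ W → Fmin ≤ F₀ - J' * ℓ) → G N Fmin :=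
  Theorems.stub_ladderInductionChains

/-- **(INDUCTION-OF-CHAINS) stub_ladderInductionOfChains** — LANDED p115281. [folklore] -/
theorem stub_ladderInductionOfChains :
    (∀ (G : ℕ → ℝ → Prop) (N m₀ : ℕ) (W F₀ ℓ Fmin : ℝ), Even N → Even m₀ → |(m₀ : ℝ) - (N : ℝ)| ≤ W → 2 ≤ m₀ → (∀ (m : ℕ) (F F' : ℝ), F' ≤ F → G m F → G m F') → G m₀ F₀ → (∀ (n : ℕ) (F : ℝ), Even n → N ≤ n → n + 2 ≤ m₀ → Fmin ≤ F → G (n + 2) F → G n (F - ℓ)) → (∀ (n : ℕ) (F : ℝ), Even n → m₀ ≤ n + 2 → n + 4 ≤ N → Fmin ≤ F → G (n + 2) F → G (n + 4) (F - ℓ)) → 0 ≤ ℓ → (∀ J' : ℝ, 0 ≤ J' → 2 * J' ≤ W → Fmin ≤ F₀ - J' * ℓ) → G N Fmin) →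
    (∃ K : ℝ, 0 ≤ K ∧ ∀ (U : ℝ) (L : ℕ) [NeZero L] (n : ℕ) (τ ρ θ B lam : ℝ), 0 < τ → 0 ≤ ρ → 0 ≤ θ → 2 * θ ≤ τ → (∀ v ∈ Submodule.span ℂ {φ : Fock (Orb (FermionTorus 2 L)) | φ ∈ szSector n 0 ∧ ∃ E : ℝ, hubbardTorus 2 L 1 U *ᵥ φ = (E : ℂ) • φ ∧ E ≤ (hubbardTorus 2 L 1 U).minEnergyOn (szSector n 0) + τ}, (star (((pairField dWaveFormFactor L)ᴴ * pairField dWaveFormFactor L) *ᵥ v - ((lam * (L : ℝ) ^ 4 : ℝ) : ℂ) • v) ⬝ᵥ (((pairField dWaveFormFactor L)ᴴ * pairField dWaveFormFactor L) *ᵥ v - ((lam * (L : ℝ) ^ 4 : ℝ) : ℂ) • v)).re ≤ ρ ^ 2 * (L : ℝ) ^ 8 * (star v ⬝ᵥ v).re) → ∀ φ : Fock (Orb (FermionTorus 2 L)), φ ∈ szSector n 0 → star φ ⬝ᵥ φ = 1 → (expect (hubbardTorus 2 L 1 U) φ).re ≤ (hubbardTorus 2 L 1 U).minEnergyOn (szSector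 n 0) + θ → B ≤ (expect ((pairField dWaveFormFactor L)ᴴ * pairField dWaveFormFactor L) φ).re → ∀ u ∈ Submodule.span ℂ {φ : Fock (Orb (FermionTorus 2 L)) | φ ∈ szSector n 0 ∧ ∃ E : ℝ, hubbardTorus 2 L 1 U *ᵥ φ = (E : ℂ) • φ ∧ E ≤ (hubbardTorus 2 L 1 U).minEnergyOn (szSector n 0) + τ}, star u ⬝ᵥ u = 1 → B - 4 * ρ * (L : ℝ) ^ 4 - K * (θ / τ) * (L : ℝ) ^ 4 ≤ (expect ((pairField dWaveFormFactor L)ᴴ * pairField dWaveFormFactor L) u).re) → ∀ (U δ : ℝ), δ ∈ Set.Ioo (0:ℝ) 1 → (∀ (U a : ℝ), 0 < a → ∃ C : ℝ, ∀ (L : ℕ) [NeZero L] (m : ℕ) (ψ : Fock (Orb (FermionTorus 2 L))), a * (L : ℝ) ^ 2 ≤ (m : ℝ) → (m : ℝ) + 4 ≤ (2 - a) * (L : ℝ) ^ 2 → IsGroundStateInSector (hubbardTorus 2 L 1 U) (m + 2) 0 ψ → star ψ ⬝ᵥ ψ = 1 → pairField dWaveFormFactor L *ᵥ ψ ∈ szSector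 m 0 ∧ (pairField dWaveFormFactor L)ᴴ *ᵥ ψ ∈ szSector (m + 4) 0 ∧ (expect (hubbardTorus 2 L 1 U) (pairField dWaveFormFactor L *ᵥ ψ)).re - (hubbardTorus 2 L 1 U).minEnergyOn (szSector m 0) * (expect ((pairField dWaveFormFactor L)ᴴ * pairField dWaveFormFactor L) ψ).re + ((expect (hubbardTorus 2 L 1 U) ((pairField dWaveFormFactor L)ᴴ *ᵥ ψ)).re - (hubbardTorus 2 L 1 U).minEnergyOn (szSector (m + 4) 0) * (expect (pairField dWaveFormFactor L * (pairField dWaveFormFactor L)ᴴ) ψ).re) ≤ C * (L : ℝ) ^ 2 + max 0 (2 * (hubbardTorus 2 L 1 U).minEnergyOn (szSector (m + 2) 0) - (hubbardTorus 2 L 1 U).minEnergyOn (szSector m 0) - (hubbardTorus 2 L 1 U).minEnergyOn (szSector (m + 4) 0)) * (expect ((pairField dWaveFormFactor L)ᴴ * pairField dWaveFormFactor L) ψ).re ∧ (expect ((pairField dWaveFormFactor L)ᴴ * pairField dWaveFormFactor L) ψ).re ^ 2 - C * (L : ℝ) ^ 2 * (expect ((pairField dWaveFormFactor L)ᴴ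 * pairField dWaveFormFactor L) ψ).re ≤ (expect ((pairField dWaveFormFactor L)ᴴ * pairField dWaveFormFactor L) (pairField dWaveFormFactor L *ᵥ ψ)).re ∧ (expect (pairField dWaveFormFactor L * (pairField dWaveFormFactor L)ᴴ) ψ).re ^ 2 ≤ (expect ((pairField dWaveFormFactor L)ᴴ * pairField dWaveFormFactor L) ((pairField dWaveFormFactor L)ᴴ *ᵥ ψ)).re ∧ |(expect (pairField dWaveFormFactor L * (pairField dWaveFormFactor L)ᴴ) ψ).re - (expect ((pairField dWaveFormFactor L)ᴴ * pairField dWaveFormFactor L) ψ).re| ≤ C * (L : ℝ) ^ 2) → (∃ b ε E₁ : ℝ, 0 < b ∧ ε ∈ Set.Ioo (0:ℝ) 1 ∧ ∃ L₀ : ℕ, ∀ (L : ℕ) [NeZero L], L₀ ≤ L → Even L → ∃ (m : ℕ) (φ : Fock (Orb (FermionTorus 2 L))), Even m ∧ |(m : ℝ) - ((2 * ⌊(1 - δ) * (L : ℝ) ^ 2 / 2⌋₊ : ℕ) : ℝ)| ≤ (L : ℝ) ^ (1 - ε) ∧ φ ∈ szSector m 0 ∧ star φ ⬝ᵥ φ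 = 1 ∧ (expect (hubbardTorus 2 L 1 U) φ).re ≤ (hubbardTorus 2 L 1 U).minEnergyOn (szSector m 0) + E₁ / (L : ℝ) ∧ b * (L : ℝ) ^ 4 ≤ (expect ((pairField dWaveFormFactor L)ᴴ * pairField dWaveFormFactor L) φ).re) → (∀ ε ∈ Set.Ioo (0:ℝ) 1, ∀ A : ℝ, 0 < A → ∃ (C : ℝ) (L₀ : ℕ), ∀ (L : ℕ) [NeZero L], L₀ ≤ L → Even L → ∀ m : ℕ, |(m : ℝ) - ((2 * ⌊(1 - δ) * (L : ℝ) ^ 2 / 2⌋₊ : ℕ) : ℝ)| ≤ (L : ℝ) ^ (1 - ε) → ∃ lam : ℝ, ∀ v ∈ Submodule.span ℂ {φ : Fock (Orb (FermionTorus 2 L)) | φ ∈ szSector m 0 ∧ ∃ E : ℝ, hubbardTorus 2 L 1 U *ᵥ φ = (E : ℂ) • φ ∧ E ≤ (hubbardTorus 2 L 1 U).minEnergyOn (szSector m 0) + A / (L : ℝ)}, (star (((pairField dWaveFormFactor L)ᴴ * pairField dWaveFormFactor L) *ᵥ v - ((lam * (L : ℝ) ^ 4 : ℝ) : ℂ)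 • v) ⬝ᵥ (((pairField dWaveFormFactor L)ᴴ * pairField dWaveFormFactor L) *ᵥ v - ((lam * (L : ℝ) ^ 4 : ℝ) : ℂ) • v)).re ≤ (C / (L : ℝ)) ^ 2 * (L : ℝ) ^ 8 * (star v ⬝ᵥ v).re) → (∀ ε ∈ Set.Ioo (0:ℝ) 1, ∃ (C : ℝ) (L₀ : ℕ), ∀ (L : ℕ) [NeZero L], L₀ ≤ L → Even L → ∀ m : ℕ, |((m + 2 : ℕ) : ℝ) - ((2 * ⌊(1 - δ) * (L : ℝ) ^ 2 / 2⌋₊ : ℕ) : ℝ)| ≤ (L : ℝ) ^ (1 - ε) → 2 * (hubbardTorus 2 L 1 U).minEnergyOn (szSector (m + 2) 0) - (hubbardTorus 2 L 1 U).minEnergyOn (szSector m 0) - (hubbardTorus 2 L 1 U).minEnergyOn (szSector (m + 4) 0) ≤ C / (L : ℝ) ^ 2) → ∃ a : ℝ, 0 < a ∧ ∀ᶠ k : ℕ in Filter.atTop, ∀ ψ : Fock (Orb (FermionTorus 2 (2 * k + 1 + 1))), IsGroundStateInSector (hubbardTorus 2 (2 * k + 1 + 1) 1 U) (2 * ⌊(1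 - δ) * ((2 * k + 1 + 1 : ℕ) : ℝ) ^ 2 / 2⌋₊) 0 ψ → star ψ ⬝ᵥ ψ = 1 → a * ((2 * k + 1 + 1 : ℕ) : ℝ) ^ 4 ≤ (expect ((pairField dWaveFormFactor (2 * k + 1 + 1))ᴴ * pairField dWaveFormFactor (2 * k + 1 + 1)) ψ).re :=
  Theorems.stub_ladderInductionOfChains

/-- **(INDUCTION) stub_ladderInduction** — the registered INDUCTION signature, LANDED p115281. [folklore] -/
theorem stub_ladderInduction :
    (∃ K : ℝ, 0 ≤ K ∧ ∀ (U : ℝ) (L : ℕ) [NeZero L] (n : ℕ) (τ ρ θ B lam : ℝ), 0 < τ → 0 ≤ ρ → 0 ≤ θ → 2 * θ ≤ τ → (∀ v ∈ Submodule.span ℂ {φ : Fock (Orb (FermionTorus 2 L)) | φ ∈ szSector n 0 ∧ ∃ E : ℝ, hubbardTorus 2 L 1 U *ᵥ φ = (E : ℂ) • φ ∧ E ≤ (hubbardTorus 2 L 1 U).minEnergyOn (szSector n 0) + τ}, (star (((pairField dWaveFormFactor L)ᴴ * pairField dWaveFormFactor L) *ᵥ v - ((lam * (L : ℝ) ^ 4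 : ℝ) : ℂ) • v) ⬝ᵥ (((pairField dWaveFormFactor L)ᴴ * pairField dWaveFormFactor L) *ᵥ v - ((lam * (L : ℝ) ^ 4 : ℝ) : ℂ) • v)).re ≤ ρ ^ 2 * (L : ℝ) ^ 8 * (star v ⬝ᵥ v).re) → ∀ φ : Fock (Orb (FermionTorus 2 L)), φ ∈ szSector n 0 → star φ ⬝ᵥ φ = 1 → (expect (hubbardTorus 2 L 1 U) φ).re ≤ (hubbardTorus 2 L 1 U).minEnergyOn (szSector n 0) + θ → B ≤ (expect ((pairField dWaveFormFactor L)ᴴ * pairField dWaveFormFactor L) φ).re → ∀ u ∈ Submodule.span ℂ {φ : Fock (Orb (FermionTorus 2 L)) | φ ∈ szSector n 0 ∧ ∃ E : ℝ, hubbardTorus 2 L 1 U *ᵥ φ = (E : ℂ) • φ ∧ E ≤ (hubbardTorus 2 L 1 U).minEnergyOn (szSector n 0) + τ}, star u ⬝ᵥ u = 1 → B - 4 * ρ * (L : ℝ) ^ 4 - K * (θ / τ) * (L : ℝ) ^ 4 ≤ (expect ((pairField dWaveFormFactor L)ᴴ * pairField dWaveFormFactor L) u).re) → ∀ (U δ :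 ℝ), δ ∈ Set.Ioo (0:ℝ) 1 → (∀ (U a : ℝ), 0 < a → ∃ C : ℝ, ∀ (L : ℕ) [NeZero L] (m : ℕ) (ψ : Fock (Orb (FermionTorus 2 L))), a * (L : ℝ) ^ 2 ≤ (m : ℝ) → (m : ℝ) + 4 ≤ (2 - a) * (L : ℝ) ^ 2 → IsGroundStateInSector (hubbardTorus 2 L 1 U) (m + 2) 0 ψ → star ψ ⬝ᵥ ψ = 1 → pairField dWaveFormFactor L *ᵥ ψ ∈ szSector m 0 ∧ (pairField dWaveFormFactor L)ᴴ *ᵥ ψ ∈ szSector (m + 4) 0 ∧ (expect (hubbardTorus 2 L 1 U) (pairField dWaveFormFactor L *ᵥ ψ)).re - (hubbardTorus 2 L 1 U).minEnergyOn (szSector m 0) * (expect ((pairField dWaveFormFactor L)ᴴ * pairField dWaveFormFactor L) ψ).re + ((expect (hubbardTorus 2 L 1 U) ((pairField dWaveFormFactor L)ᴴ *ᵥ ψ)).re - (hubbardTorus 2 L 1 U).minEnergyOn (szSector (m + 4) 0) * (expect (pairField dWaveFormFactor L * (pairField dWaveFormFactor L)ᴴ) ψ).re) ≤ C * (L : ℝ)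 ^ 2 + max 0 (2 * (hubbardTorus 2 L 1 U).minEnergyOn (szSector (m + 2) 0) - (hubbardTorus 2 L 1 U).minEnergyOn (szSector m 0) - (hubbardTorus 2 L 1 U).minEnergyOn (szSector (m + 4) 0)) * (expect ((pairField dWaveFormFactor L)ᴴ * pairField dWaveFormFactor L) ψ).re ∧ (expect ((pairField dWaveFormFactor L)ᴴ * pairField dWaveFormFactor L) ψ).re ^ 2 - C * (L : ℝ) ^ 2 * (expect ((pairField dWaveFormFactor L)ᴴ * pairField dWaveFormFactor L) ψ).re ≤ (expect ((pairField dWaveFormFactor L)ᴴ * pairField dWaveFormFactor L) (pairField dWaveFormFactor L *ᵥ ψ)).re ∧ (expect (pairField dWaveFormFactor L * (pairField dWaveFormFactor L)ᴴ) ψ).re ^ 2 ≤ (expect ((pairField dWaveFormFactor L)ᴴ * pairField dWaveFormFactor L) ((pairField dWaveFormFactor L)ᴴ *ᵥ ψ)).re ∧ |(expect (pairField dWaveFormFactor L * (pairField dWaveFormFactor L)ᴴ) ψ).re - (expect ((pairField dWaveFormFactor L)ᴴ * pairField dWaveFormFactor L) ψ).re| ≤ C * (L : ℝ) ^ 2)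 → (∃ b ε E₁ : ℝ, 0 < b ∧ ε ∈ Set.Ioo (0:ℝ) 1 ∧ ∃ L₀ : ℕ, ∀ (L : ℕ) [NeZero L], L₀ ≤ L → Even L → ∃ (m : ℕ) (φ : Fock (Orb (FermionTorus 2 L))), Even m ∧ |(m : ℝ) - ((2 * ⌊(1 - δ) * (L : ℝ) ^ 2 / 2⌋₊ : ℕ) : ℝ)| ≤ (L : ℝ) ^ (1 - ε) ∧ φ ∈ szSector m 0 ∧ star φ ⬝ᵥ φ = 1 ∧ (expect (hubbardTorus 2 L 1 U) φ).re ≤ (hubbardTorus 2 L 1 U).minEnergyOn (szSector m 0) + E₁ / (L : ℝ) ∧ b * (L : ℝ) ^ 4 ≤ (expect ((pairField dWaveFormFactor L)ᴴ * pairField dWaveFormFactor L) φ).re) → (∀ ε ∈ Set.Ioo (0:ℝ) 1, ∀ A : ℝ, 0 < A → ∃ (C : ℝ) (L₀ : ℕ), ∀ (L : ℕ) [NeZero L], L₀ ≤ L → Even L → ∀ m : ℕ, |(m : ℝ) - ((2 * ⌊(1 - δ) * (L : ℝ) ^ 2 / 2⌋₊ : ℕ) : ℝ)| ≤ (L : ℝ)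 ^ (1 - ε) → ∃ lam : ℝ, ∀ v ∈ Submodule.span ℂ {φ : Fock (Orb (FermionTorus 2 L)) | φ ∈ szSector m 0 ∧ ∃ E : ℝ, hubbardTorus 2 L 1 U *ᵥ φ = (E : ℂ) • φ ∧ E ≤ (hubbardTorus 2 L 1 U).minEnergyOn (szSector m 0) + A / (L : ℝ)}, (star (((pairField dWaveFormFactor L)ᴴ * pairField dWaveFormFactor L) *ᵥ v - ((lam * (L : ℝ) ^ 4 : ℝ) : ℂ) • v) ⬝ᵥ (((pairField dWaveFormFactor L)ᴴ * pairField dWaveFormFactor L) *ᵥ v - ((lam * (L : ℝ) ^ 4 : ℝ) : ℂ) • v)).re ≤ (C / (L : ℝ)) ^ 2 * (L : ℝ) ^ 8 * (star v ⬝ᵥ v).re) → (∀ ε ∈ Set.Ioo (0:ℝ) 1, ∃ (C : ℝ) (L₀ : ℕ), ∀ (L : ℕ) [NeZero L], L₀ ≤ L → Even L → ∀ m : ℕ, |((m + 2 : ℕ) : ℝ) - ((2 * ⌊(1 - δ) * (L : ℝ) ^ 2 / 2⌋₊ : ℕ) : ℝ)| ≤ (L : ℝ) ^ (1 - ε) →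 2 * (hubbardTorus 2 L 1 U).minEnergyOn (szSector (m + 2) 0) - (hubbardTorus 2 L 1 U).minEnergyOn (szSector m 0) - (hubbardTorus 2 L 1 U).minEnergyOn (szSector (m + 4) 0) ≤ C / (L : ℝ) ^ 2) → ∃ a : ℝ, 0 < a ∧ ∀ᶠ k : ℕ in Filter.atTop, ∀ ψ : Fock (Orb (FermionTorus 2 (2 * k + 1 + 1))), IsGroundStateInSector (hubbardTorus 2 (2 * k + 1 + 1) 1 U) (2 * ⌊(1 - δ) * ((2 * k + 1 + 1 : ℕ) : ℝ) ^ 2 / 2⌋₊) 0 ψ → star ψ ⬝ᵥ ψ = 1 → a * ((2 * k + 1 + 1 : ℕ) : ℝ) ^ 4 ≤ (expect ((pairField dWaveFormFactor (2 * k + 1 + 1))ᴴ * pairField dWaveFormFactor (2 * k + 1 + 1)) ψ).re :=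
  stub_ladderInductionOfChains stub_ladderInductionChains

/-! ## The registered stubs — open physics of the line (signatures verbatim) -/

/-- **(SEED) stub_sourcedBrightSeed** — ONE bright (`⟨PᴴP⟩ ≥ bL⁴`), low-excess (`≤ E₁/L`) normalised vector in SOME even
sector within `L^{1-ε}` of `N_L`, for all large even `L`, under the crux antecedents. OPEN PHYSICS; crux-NECESSARY
(`sourcedBrightSeed_of_crux`, p114473); its `E₁/L` excess clause is two orders below the `O(hL²)` excess of number-projected
sourced grand-canonical ground vectors. [folklore] -/
theorem stub_sourcedBrightSeed :
    ∀ (U δ μ : ℝ), 0 < U → δ ∈ Set.Ioo (0:ℝ) 1 → Filter.Tendsto (fun L : ℕ => ((hubbardTorusWith 2 (L + 1) 1 U μ).groundStateFunctional totalNumber).re / ((L + 1 : ℕ) : ℝ) ^ 2) Filter.atTop (nhds (1 - δ)) → HasDWaveOrder U μ → ∃ b ε E₁ : ℝ, 0 < b ∧ ε ∈ Set.Ioo (0:ℝ) 1 ∧ ∃ L₀ : ℕ, ∀ (L : ℕ) [NeZero L], L₀ ≤ L → Even L → ∃ (m : ℕ) (φ : Fock (Orb (FermionTorus 2 L))), Even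 m ∧ |(m : ℝ) - ((2 * ⌊(1 - δ) * (L : ℝ) ^ 2 / 2⌋₊ : ℕ) : ℝ)| ≤ (L : ℝ) ^ (1 - ε) ∧ φ ∈ szSector m 0 ∧ star φ ⬝ᵥ φ = 1 ∧ (expect (hubbardTorus 2 L 1 U) φ).re ≤ (hubbardTorus 2 L 1 U).minEnergyOn (szSector m 0) + E₁ / (L : ℝ) ∧ b * (L : ℝ) ^ 4 ≤ (expect ((pairField dWaveFormFactor L)ᴴ * pairField dWaveFormFactor L) φ).re := by
  sorry

/-- **(RIGIDITY) stub_lowManifoldRigidity** — `PᴴP` within `CL³` of a scalar `λL⁴` on the low manifold `V_m(A/L)` of every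
sector `(m, 0)` with `|m − N_L| ≤ L^{1-ε}`. OPEN PHYSICS — the every-low-state content of the line; its `m = N_L` instance
alone already makes the crux equivalent to a summit-sector seed (`SsbToEvenTorusLro_iff_summitSectorSeed`, p114795). [folklore] -/
theorem stub_lowManifoldRigidity :
    ∀ (U δ μ : ℝ), 0 < U → δ ∈ Set.Ioo (0:ℝ) 1 → Filter.Tendsto (fun L : ℕ => ((hubbardTorusWith 2 (L + 1) 1 U μ).groundStateFunctional totalNumber).re / ((L + 1 : ℕ) : ℝ) ^ 2) Filter.atTop (nhds (1 - δ)) → HasDWaveOrder U μ → ∀ ε ∈ Set.Ioo (0:ℝ) 1, ∀ A : ℝ, 0 < A → ∃ (C : ℝ) (L₀ : ℕ), ∀ (L : ℕ) [NeZero L], L₀ ≤ L → Even L → ∀ m : ℕ, |(m : ℝ) - ((2 * ⌊(1 - δ) * (L : ℝ) ^ 2 / 2⌋₊ : ℕ) : ℝ)| ≤ (L : ℝ) ^ (1 - ε) → ∃ lam : ℝ, ∀ v ∈ Submodule.span ℂ {φ : Fock (Orb (FermionTorus 2 L)) | φ ∈ szSector m 0 ∧ ∃ E : ℝ, hubbardTorus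 2 L 1 U *ᵥ φ = (E : ℂ) • φ ∧ E ≤ (hubbardTorus 2 L 1 U).minEnergyOn (szSector m 0) + A / (L : ℝ)}, (star (((pairField dWaveFormFactor L)ᴴ * pairField dWaveFormFactor L) *ᵥ v - ((lam * (L : ℝ) ^ 4 : ℝ) : ℂ) • v) ⬝ᵥ (((pairField dWaveFormFactor L)ᴴ * pairField dWaveFormFactor L) *ᵥ v - ((lam * (L : ℝ) ^ 4 : ℝ) : ℂ) • v)).re ≤ (C / (L : ℝ)) ^ 2 * (L : ℝ) ^ 8 * (star v ⬝ᵥ v).re := by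
  sorry

/-- **(RIGIDITY, weak form) stub_lowManifoldRigidityWeak** — RESHAPED residue (lead c3): the same rigidity with
tolerance `ϱ·L^{3+ε}` for EVERY `ϱ > 0` eventually (absolute `o(L^{3+ε})`, `ε` the window exponent) instead of `CL³` — robust
against the 2-d spin-wave estimate `L³(log L)^{1/2}`; it still closes the ladder (`stub_uniformFloorOfWeakRigidity`, p117927:
`(L^{1−ε}/2)·4ϱL^{3+ε} = 2ϱL⁴`). OPEN PHYSICS. [folklore] -/
theorem stub_lowManifoldRigidityWeak :
    ∀ (U δ μ : ℝ), 0 < U → δ ∈ Set.Ioo (0:ℝ) 1 → Filter.Tendsto (fun L : ℕ => ((hubbardTorusWith 2 (L + 1) 1 U μ).groundStateFunctional totalNumber).re / ((L + 1 : ℕ) : ℝ) ^ 2) Filter.atTop (nhds (1 - δ)) → HasDWaveOrder U μ → ∀ ε ∈ Set.Ioo (0:ℝ) 1, ∀ A : ℝ, 0 < A → ∀ ϱ : ℝ, 0 < ϱ → ∃ L₀ : ℕ, ∀ (L : ℕ) [NeZero L], L₀ ≤ L → Even L → ∀ m : ℕ, |(m : ℝ) - (((2 * ⌊(1 - δ)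 * (L : ℝ) ^ 2 / 2⌋₊) : ℕ) : ℝ)| ≤ (L : ℝ) ^ (1 - ε) → ∃ lam : ℝ, ∀ v ∈ Submodule.span ℂ {φ : Fock (Orb (FermionTorus 2 L)) | φ ∈ szSector m 0 ∧ ∃ E : ℝ, hubbardTorus 2 L 1 U *ᵥ φ = (E : ℂ) • φ ∧ E ≤ (hubbardTorus 2 L 1 U).minEnergyOn (szSector m 0) + A / (L : ℝ)}, (star (((pairField dWaveFormFactor L)ᴴ * pairField dWaveFormFactor L) *ᵥ v - ((lam * (L : ℝ) ^ 4 : ℝ) : ℂ) • v) ⬝ᵥ (((pairField dWaveFormFactor L)ᴴ * pairField dWaveFormFactor L) *ᵥ v - ((lam * (L : ℝ) ^ 4 : ℝ) : ℂ) • v)).re ≤ (ϱ * (L : ℝ) ^ (3 + ε)) ^ 2 * (star v ⬝ᵥ v).re := by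
  sorry

/-- **(CONVEXITY) stub_windowConvexity** — `2E_{m+2} − E_m − E_{m+4} ≤ C/L²` on the window `|m + 2 − N_L| ≤ L^{1-ε}`.
OPEN PHYSICS (finite-`L` thermodynamic stability at resolution `1/L²`; not needed when the seed sits in `N_L`). [folklore] -/
theorem stub_windowConvexity :
    ∀ (U δ μ : ℝ), 0 < U → δ ∈ Set.Ioo (0:ℝ) 1 → Filter.Tendsto (fun L : ℕ => ((hubbardTorusWith 2 (L + 1) 1 U μ).groundStateFunctional totalNumber).re / ((L + 1 : ℕ) : ℝ) ^ 2) Filter.atTop (nhds (1 - δ)) → HasDWaveOrder U μ → ∀ ε ∈ Set.Ioo (0:ℝ) 1, ∃ (C : ℝ) (L₀ : ℕ), ∀ (L : ℕ) [NeZero L], L₀ ≤ L → Even L → ∀ m : ℕ, |((m + 2 : ℕ) : ℝ) - ((2 * ⌊(1 - δ) * (L : ℝ) ^ 2 / 2⌋₊ : ℕ) : ℝ)| ≤ (L : ℝ) ^ (1 - ε) → 2 * (hubbardTorus 2 L 1 U).minEnergyOn (szSector (m + 2) 0) - (hubbardTorus 2 L 1 U).minEnergyOn (szSector m 0) - (hubbardTorus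 2 L 1 U).minEnergyOn (szSector (m + 4) 0) ≤ C / (L : ℝ) ^ 2 := by
  sorry

/-! ## The registered stubs — the sibling lines' residues carried for the census (signatures verbatim) -/

/-- **(FP) stub_facePurity** — derivative face purity of EVERY sector ground state at every fixed block scale (line
pair-yrast-landau-floor; crux-NECESSARY, `facePurity_of_crux`). OPEN PHYSICS. [folklore] -/
theorem stub_facePurity :
    ∀ (U δ μ : ℝ), 0 < U → δ ∈ Set.Ioo (0:ℝ) 1 → Filter.Tendsto (fun L : ℕ => ((hubbardTorusWith 2 (L + 1) 1 U μ).groundStateFunctional totalNumber).re / ((L + 1 : ℕ) : ℝ) ^ 2) Filter.atTop (nhds (1 - δ)) → HasDWaveOrder U μ → ∃ a : ℝ, 0 < a ∧ ∀ R : ℕ, 0 < R → ∀ᶠ k : ℕ in Filter.atTop, ∀ ψ : Fock (Orb (FermionTorus 2 (2 * k + 1 + 1))), IsGroundStateInSector (hubbardTorus 2 (2 * k + 1 + 1) 1 U) (2 * ⌊(1 - δ) * ((2 * k + 1 + 1 : ℕ) : ℝ) ^ 2 / 2⌋₊) 0 ψ → star ψ ⬝ᵥ ψ = 1 → a * ((2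 * k + 1 + 1 : ℕ) : ℝ) ^ 2 ≤ (star ψ ⬝ᵥ ((((((R : ℝ) ^ 4)⁻¹ : ℝ) : ℂ) • ∑ x : TorusSite 2 (2 * k + 1 + 1), (∑ u : Fin 2 → Fin R, localPair dWaveFormFactor (2 * k + 1 + 1) (x + fun i => ((u i : ℕ) : ZMod (2 * k + 1 + 1))))ᴴ * (∑ u : Fin 2 → Fin R, localPair dWaveFormFactor (2 * k + 1 + 1) (x + fun i => ((u i : ℕ) : ZMod (2 * k + 1 + 1))))) *ᵥ ψ)).re := by
  sorry

/-- **(leak) stub_infraredLeak** — the weakest infrared input of the sibling lines (item stmt-1089 is its `δ < 1/2` half).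
OPEN PHYSICS; NOT needed by this line. [folklore] -/
theorem stub_infraredLeak :
    ∀ (U δ μ : ℝ), 0 < U → δ ∈ Set.Ioo (0:ℝ) 1 → Filter.Tendsto (fun L : ℕ => ((hubbardTorusWith 2 (L + 1) 1 U μ).groundStateFunctional totalNumber).re / ((L + 1 : ℕ) : ℝ) ^ 2) Filter.atTop (nhds (1 - δ)) → HasDWaveOrder U μ → ∀ b : ℝ, 0 < b → ∃ η : ℝ, 0 < η ∧ ∀ᶠ k : ℕ in Filter.atTop, ∀ ψ : Fock (Orb (FermionTorus 2 (2 * k + 1 + 1))), IsGroundStateInSector (hubbardTorus 2 (2 * k + 1 + 1) 1 U) (2 * ⌊(1 - δ) * ((((2 * k + 1 + 1)) : ℕ) : ℝ) ^ 2 / 2⌋₊) 0 ψ → star ψ ⬝ᵥ ψ = 1 → (∑ m ∈ (Finset.univ.filter fun m : Literature.Probability.LatticeModels.TorusSite 2 (2 * k + 1 + 1) => m ≠ 0 ∧ momentumNormSq (2 * k + 1 + 1) m < η ^ 2), pairStructureFactor dWaveFormFactor (2 * k + 1 + 1) ψ m) / (((2 * k + 1 + 1) : ℕ) : ℝ) ^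 2 ≤ b := by
  sorry

/-! ## Composition (no `sorry` below this line) -/

/-- **(LADDER) stub_ladderPropagation** — the planner's registered LADDER signature; LANDED p115281
(`Theorems.stub_ladderPropagation = stub_ladderInduction stub_lowManifoldTransfer`). [folklore] -/
theorem stub_ladderPropagation :
    ∀ (U δ : ℝ), δ ∈ Set.Ioo (0:ℝ) 1 → (∀ (U a : ℝ), 0 < a → ∃ C : ℝ, ∀ (L : ℕ) [NeZero L] (m : ℕ) (ψ : Fock (Orb (FermionTorus 2 L))), a * (L : ℝ) ^ 2 ≤ (m : ℝ) → (m : ℝ) + 4 ≤ (2 - a) * (L : ℝ) ^ 2 → IsGroundStateInSector (hubbardTorus 2 L 1 U) (m + 2) 0 ψ → star ψ ⬝ᵥ ψ = 1 → pairField dWaveFormFactor L *ᵥ ψ ∈ szSector m 0 ∧ (pairField dWaveFormFactor L)ᴴ *ᵥ ψ ∈ szSector (m + 4) 0 ∧ (expect (hubbardTorus 2 L 1 U) (pairField dWaveFormFactor L *ᵥ ψ)).re - (hubbardTorus 2 L 1 U).minEnergyOn (szSector m 0) * (expect ((pairField dWaveFormFactor L)ᴴ * pairField dWaveFormFactor L)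 ψ).re + ((expect (hubbardTorus 2 L 1 U) ((pairField dWaveFormFactor L)ᴴ *ᵥ ψ)).re - (hubbardTorus 2 L 1 U).minEnergyOn (szSector (m + 4) 0) * (expect (pairField dWaveFormFactor L * (pairField dWaveFormFactor L)ᴴ) ψ).re) ≤ C * (L : ℝ) ^ 2 + max 0 (2 * (hubbardTorus 2 L 1 U).minEnergyOn (szSector (m + 2) 0) - (hubbardTorus 2 L 1 U).minEnergyOn (szSector m 0) - (hubbardTorus 2 L 1 U).minEnergyOn (szSector (m + 4) 0)) * (expect ((pairField dWaveFormFactor L)ᴴ * pairField dWaveFormFactor L) ψ).re ∧ (expect ((pairField dWaveFormFactor L)ᴴ * pairField dWaveFormFactor L) ψ).re ^ 2 - C * (L : ℝ) ^ 2 * (expect ((pairField dWaveFormFactor L)ᴴ * pairField dWaveFormFactor L) ψ).re ≤ (expect ((pairField dWaveFormFactor L)ᴴ * pairField dWaveFormFactor L) (pairField dWaveFormFactor L *ᵥ ψ)).re ∧ (expect (pairField dWaveFormFactor L * (pairField dWaveFormFactor L)ᴴ) ψ).re ^ 2 ≤ (expect ((pairField dWaveFormFactor L)ᴴ * pairField dWaveFormFactor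 L) ((pairField dWaveFormFactor L)ᴴ *ᵥ ψ)).re ∧ |(expect (pairField dWaveFormFactor L * (pairField dWaveFormFactor L)ᴴ) ψ).re - (expect ((pairField dWaveFormFactor L)ᴴ * pairField dWaveFormFactor L) ψ).re| ≤ C * (L : ℝ) ^ 2) → (∃ b ε E₁ : ℝ, 0 < b ∧ ε ∈ Set.Ioo (0:ℝ) 1 ∧ ∃ L₀ : ℕ, ∀ (L : ℕ) [NeZero L], L₀ ≤ L → Even L → ∃ (m : ℕ) (φ : Fock (Orb (FermionTorus 2 L))), Even m ∧ |(m : ℝ) - ((2 * ⌊(1 - δ) * (L : ℝ) ^ 2 / 2⌋₊ : ℕ) : ℝ)| ≤ (L : ℝ) ^ (1 - ε) ∧ φ ∈ szSector m 0 ∧ star φ ⬝ᵥ φ = 1 ∧ (expect (hubbardTorus 2 L 1 U) φ).re ≤ (hubbardTorus 2 L 1 U).minEnergyOn (szSector m 0) + E₁ / (L : ℝ) ∧ b * (L : ℝ) ^ 4 ≤ (expect ((pairField dWaveFormFactor L)ᴴ * pairField dWaveFormFactor L) φ).re) → (∀ ε ∈ Set.Ioo (0:ℝ) 1, ∀ A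 : ℝ, 0 < A → ∃ (C : ℝ) (L₀ : ℕ), ∀ (L : ℕ) [NeZero L], L₀ ≤ L → Even L → ∀ m : ℕ, |(m : ℝ) - ((2 * ⌊(1 - δ) * (L : ℝ) ^ 2 / 2⌋₊ : ℕ) : ℝ)| ≤ (L : ℝ) ^ (1 - ε) → ∃ lam : ℝ, ∀ v ∈ Submodule.span ℂ {φ : Fock (Orb (FermionTorus 2 L)) | φ ∈ szSector m 0 ∧ ∃ E : ℝ, hubbardTorus 2 L 1 U *ᵥ φ = (E : ℂ) • φ ∧ E ≤ (hubbardTorus 2 L 1 U).minEnergyOn (szSector m 0) + A / (L : ℝ)}, (star (((pairField dWaveFormFactor L)ᴴ * pairField dWaveFormFactor L) *ᵥ v - ((lam * (L : ℝ) ^ 4 : ℝ) : ℂ) • v) ⬝ᵥ (((pairField dWaveFormFactor L)ᴴ * pairField dWaveFormFactor L) *ᵥ v - ((lam * (L : ℝ) ^ 4 : ℝ) : ℂ) • v)).re ≤ (C / (L : ℝ)) ^ 2 * (L : ℝ) ^ 8 * (star v ⬝ᵥ v).re) → (∀ ε ∈ Set.Ioo (0:ℝ) 1, ∃ (C : ℝ)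 (L₀ : ℕ), ∀ (L : ℕ) [NeZero L], L₀ ≤ L → Even L → ∀ m : ℕ, |((m + 2 : ℕ) : ℝ) - ((2 * ⌊(1 - δ) * (L : ℝ) ^ 2 / 2⌋₊ : ℕ) : ℝ)| ≤ (L : ℝ) ^ (1 - ε) → 2 * (hubbardTorus 2 L 1 U).minEnergyOn (szSector (m + 2) 0) - (hubbardTorus 2 L 1 U).minEnergyOn (szSector m 0) - (hubbardTorus 2 L 1 U).minEnergyOn (szSector (m + 4) 0) ≤ C / (L : ℝ) ^ 2) → ∃ a : ℝ, 0 < a ∧ ∀ᶠ k : ℕ in Filter.atTop, ∀ ψ : Fock (Orb (FermionTorus 2 (2 * k + 1 + 1))), IsGroundStateInSector (hubbardTorus 2 (2 * k + 1 + 1) 1 U) (2 * ⌊(1 - δ) * ((2 * k + 1 + 1 : ℕ) : ℝ) ^ 2 / 2⌋₊) 0 ψ → star ψ ⬝ᵥ ψ = 1 → a * ((2 * k + 1 + 1 : ℕ) : ℝ) ^ 4 ≤ (expect ((pairField dWaveFormFactor (2 * k + 1 + 1))ᴴ * pairField dWaveFormFactor (2 * k + 1 + 1)) ψ).re :=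
  Theorems.stub_ladderPropagation

/-- The uniform pair floor at `(U, δ)` from the four inputs of the line (RUNG, SEED, RIGIDITY, CONVEXITY) — one
application of the LADDER. [folklore] -/
theorem uniformPairFloor_of_floatingMu {U δ μ : ℝ} (hU : 0 < U) (hδ : δ ∈ Set.Ioo (0:ℝ) 1)
    (hD : Filter.Tendsto (fun L : ℕ => ((hubbardTorusWith 2 (L + 1) 1 U μ).groundStateFunctional totalNumber).re / ((L + 1 : ℕ) : ℝ) ^ 2) Filter.atTop (nhds (1 - δ)))
    (hO : HasDWaveOrder U μ) :
    ∃ a : ℝ, 0 < a ∧ ∀ᶠ k : ℕ in Filter.atTop, ∀ ψ : Fock (Orb (FermionTorus 2 (2 * k + 1 + 1))), IsGroundStateInSector (hubbardTorus 2 (2 * k + 1 + 1) 1 U) (2 * ⌊(1 - δ) * ((2 * k + 1 + 1 : ℕ) : ℝ) ^ 2 / 2⌋₊) 0 ψ → star ψ ⬝ᵥ ψ = 1 → a * ((2 * k + 1 + 1 : ℕ) : ℝ) ^ 4 ≤ (expect ((pairField dWaveFormFactor (2 * k + 1 + 1))ᴴ * pairField dWaveFormFactor (2 * k + 1 + 1))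 ψ).re :=
  stub_ladderPropagation U δ hδ stub_pairTransferRung (stub_sourcedBrightSeed U δ μ hU hδ hD hO)
    (stub_lowManifoldRigidity U δ μ hU hδ hD hO) (stub_windowConvexity U δ μ hU hδ hD hO)

/-- **Door A — `SsbToEvenTorusLro` from the floating-μ line** (RUNG ∧ SEED ∧ RIGIDITY ∧ CONVEXITY, via the LADDER and the
landed uniform-floor kernel `hasDWavePairFieldLROAt_of_floor`). [folklore] -/
theorem SsbToEvenTorusLro_of : SsbToEvenTorusLro :=
  fun _ _ _ hU hδ hD hO => hasDWavePairFieldLROAt_of_floor (uniformPairFloor_of_floatingMu hU hδ hD hO)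

/-- **Door A′ — `SsbToEvenTorusLro` from SEED ∧ WEAK RIGIDITY ∧ CONVEXITY** (landed weak-rigidity ladder
`Theorems.stub_uniformFloorOfWeakRigidity`, p117927, + the floor kernel). [folklore] -/
theorem SsbToEvenTorusLro_of_weakRigidity : SsbToEvenTorusLro :=
  fun U δ μ hU hδ hD hO => hasDWavePairFieldLROAt_of_floor
    (Theorems.stub_uniformFloorOfWeakRigidity U δ hδ (stub_sourcedBrightSeed U δ μ hU hδ hD hO)
      (stub_lowManifoldRigidityWeak U δ μ hU hδ hD hO) (stub_windowConvexity U δ μ hU hδ hD hO))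

/-- **Necessity of (SEED)** (landed p114473). [folklore] -/
theorem sourcedBrightSeed_of_crux (h : SsbToEvenTorusLro) :
    ∀ (U δ μ : ℝ), 0 < U → δ ∈ Set.Ioo (0:ℝ) 1 → Filter.Tendsto (fun L : ℕ => ((hubbardTorusWith 2 (L + 1) 1 U μ).groundStateFunctional totalNumber).re / ((L + 1 : ℕ) : ℝ) ^ 2) Filter.atTop (nhds (1 - δ)) → HasDWaveOrder U μ → ∃ b ε E₁ : ℝ, 0 < b ∧ ε ∈ Set.Ioo (0:ℝ) 1 ∧ ∃ L₀ : ℕ, ∀ (L : ℕ) [NeZero L], L₀ ≤ L → Even L → ∃ (m : ℕ) (φ : Fock (Orb (FermionTorus 2 L))), Even m ∧ |(m : ℝ) - ((2 * ⌊(1 - δ) * (L : ℝ) ^ 2 / 2⌋₊ : ℕ) : ℝ)| ≤ (L : ℝ) ^ (1 - ε) ∧ φ ∈ szSector m 0 ∧ star φ ⬝ᵥ φ = 1 ∧ (expect (hubbardTorus 2 L 1 U) φ).re ≤ (hubbardTorus 2 L 1 U).minEnergyOn (szSector m 0) + E₁ / (L : ℝ) ∧ b * (L : ℝ) ^ 4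 ≤ (expect ((pairField dWaveFormFactor L)ᴴ * pairField dWaveFormFactor L) φ).re :=
  Theorems.sourcedBrightSeed_of_crux h

/-- **RIGIDITY ∧ CONVEXITY ⇒ (crux ⇔ SEED)**: the every-ground-state mechanism of the line isolated from its order input.
[folklore] -/
theorem SsbToEvenTorusLro_iff_seed
    (hR : ∀ (U δ μ : ℝ), 0 < U → δ ∈ Set.Ioo (0:ℝ) 1 → Filter.Tendsto (fun L : ℕ => ((hubbardTorusWith 2 (L + 1) 1 U μ).groundStateFunctional totalNumber).re / ((L + 1 : ℕ) : ℝ) ^ 2) Filter.atTop (nhds (1 - δ)) → HasDWaveOrder U μ → ∀ ε ∈ Set.Ioo (0:ℝ) 1, ∀ A : ℝ, 0 < A → ∃ (C : ℝ) (L₀ : ℕ), ∀ (L : ℕ) [NeZero L], L₀ ≤ L → Even L → ∀ m : ℕ, |(m : ℝ) - ((2 * ⌊(1 - δ) * (L : ℝ) ^ 2 / 2⌋₊ : ℕ) : ℝ)| ≤ (L : ℝ) ^ (1 - ε) → ∃ lam : ℝ, ∀ v ∈ Submodule.span ℂ {φ : Fock (Orb (FermionTorus 2 L)) | φ ∈ szSector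 m 0 ∧ ∃ E : ℝ, hubbardTorus 2 L 1 U *ᵥ φ = (E : ℂ) • φ ∧ E ≤ (hubbardTorus 2 L 1 U).minEnergyOn (szSector m 0) + A / (L : ℝ)}, (star (((pairField dWaveFormFactor L)ᴴ * pairField dWaveFormFactor L) *ᵥ v - ((lam * (L : ℝ) ^ 4 : ℝ) : ℂ) • v) ⬝ᵥ (((pairField dWaveFormFactor L)ᴴ * pairField dWaveFormFactor L) *ᵥ v - ((lam * (L : ℝ) ^ 4 : ℝ) : ℂ) • v)).re ≤ (C / (L : ℝ)) ^ 2 * (L : ℝ) ^ 8 * (star v ⬝ᵥ v).re)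
    (hC : ∀ (U δ μ : ℝ), 0 < U → δ ∈ Set.Ioo (0:ℝ) 1 → Filter.Tendsto (fun L : ℕ => ((hubbardTorusWith 2 (L + 1) 1 U μ).groundStateFunctional totalNumber).re / ((L + 1 : ℕ) : ℝ) ^ 2) Filter.atTop (nhds (1 - δ)) → HasDWaveOrder U μ → ∀ ε ∈ Set.Ioo (0:ℝ) 1, ∃ (C : ℝ) (L₀ : ℕ), ∀ (L : ℕ) [NeZero L], L₀ ≤ L → Even L → ∀ m : ℕ, |((m + 2 : ℕ) : ℝ) - ((2 * ⌊(1 - δ) * (L : ℝ) ^ 2 / 2⌋₊ : ℕ) : ℝ)| ≤ (L : ℝ) ^ (1 - ε) → 2 * (hubbardTorus 2 L 1 U).minEnergyOn (szSector (m + 2) 0) - (hubbardTorus 2 L 1 U).minEnergyOn (szSector m 0) - (hubbardTorus 2 L 1 U).minEnergyOn (szSector (m + 4) 0) ≤ C / (L : ℝ) ^ 2) :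
    SsbToEvenTorusLro ↔ (∀ (U δ μ : ℝ), 0 < U → δ ∈ Set.Ioo (0:ℝ) 1 → Filter.Tendsto (fun L : ℕ => ((hubbardTorusWith 2 (L + 1) 1 U μ).groundStateFunctional totalNumber).re / ((L + 1 : ℕ) : ℝ) ^ 2) Filter.atTop (nhds (1 - δ)) → HasDWaveOrder U μ → ∃ b ε E₁ : ℝ, 0 < b ∧ ε ∈ Set.Ioo (0:ℝ) 1 ∧ ∃ L₀ : ℕ, ∀ (L : ℕ) [NeZero L], L₀ ≤ L → Even L → ∃ (m : ℕ) (φ : Fock (Orb (FermionTorus 2 L))), Even m ∧ |(m : ℝ) - ((2 * ⌊(1 - δ) * (L : ℝ) ^ 2 / 2⌋₊ : ℕ) : ℝ)| ≤ (L : ℝ) ^ (1 - ε) ∧ φ ∈ szSector m 0 ∧ star φ ⬝ᵥ φ = 1 ∧ (expect (hubbardTorus 2 L 1 U) φ).re ≤ (hubbardTorus 2 L 1 U).minEnergyOn (szSector m 0) + E₁ / (L : ℝ) ∧ b * (L : ℝ) ^ 4 ≤ (expect ((pairField dWaveFormFactor L)ᴴ * pairField dWaveFormFactor L) φ).re) 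:=
  ⟨fun h => Theorems.sourcedBrightSeed_of_crux h, fun hS _ _ _ hU hδ hD hO =>
    hasDWavePairFieldLROAt_of_floor (stub_ladderPropagation _ _ hδ stub_pairTransferRung (hS _ _ _ hU hδ hD hO)
      (hR _ _ _ hU hδ hD hO) (hC _ _ _ hU hδ hD hO))⟩

/-- **Necessity of (FP)** (landed `facePurity_of_hasDWavePairFieldLROAt`, p90057). [folklore] -/
theorem facePurity_of_crux (h : SsbToEvenTorusLro) :
    ∀ (U δ μ : ℝ), 0 < U → δ ∈ Set.Ioo (0:ℝ) 1 → Filter.Tendsto (fun L : ℕ => ((hubbardTorusWith 2 (L + 1) 1 U μ).groundStateFunctional totalNumber).re / ((L + 1 : ℕ) : ℝ) ^ 2) Filter.atTop (nhds (1 - δ)) → HasDWaveOrder U μ → ∃ a : ℝ, 0 < a ∧ ∀ R : ℕ, 0 < R → ∀ᶠ k : ℕ in Filter.atTop, ∀ ψ : Fock (Orb (FermionTorus 2 (2 * k + 1 + 1))), IsGroundStateInSector (hubbardTorus 2 (2 * k + 1 + 1) 1 U) (2 * ⌊(1 - δ) * ((2 * k + 1 + 1 : ℕ) : ℝ) ^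 2 / 2⌋₊) 0 ψ → star ψ ⬝ᵥ ψ = 1 → a * ((2 * k + 1 + 1 : ℕ) : ℝ) ^ 2 ≤ (star ψ ⬝ᵥ ((((((R : ℝ) ^ 4)⁻¹ : ℝ) : ℂ) • ∑ x : TorusSite 2 (2 * k + 1 + 1), (∑ u : Fin 2 → Fin R, localPair dWaveFormFactor (2 * k + 1 + 1) (x + fun i => ((u i : ℕ) : ZMod (2 * k + 1 + 1))))ᴴ * (∑ u : Fin 2 → Fin R, localPair dWaveFormFactor (2 * k + 1 + 1) (x + fun i => ((u i : ℕ) : ZMod (2 * k + 1 + 1))))) *ᵥ ψ)).re :=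
  fun U δ μ hU hδ hD hO => Theorems.facePurity_of_hasDWavePairFieldLROAt hδ.1.le (h U δ μ hU hδ hD hO)

/-- **Door B — `SsbToEvenTorusLro` from (FP) ∧ (leak)** (landed door, p97872; modulo the leak the crux IS face purity). [folklore] -/
theorem SsbToEvenTorusLro_of_infraredLeak : SsbToEvenTorusLro :=
  Theorems.SsbToEvenTorusLro_of_facePurity_of_infraredLeak stub_facePurity stub_infraredLeak

end Summit.HubbardSuperconductivity.HubbardSuperconductivity.Theorems.SsbToEvenTorusLro
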